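import Summits.RiemannHypothesis.RiemannHypothesis.Theorems.SignConeConeMagnificationDesignSpineB

/-!
# Stub `stub_deficitOfDesign` of line `Sketch` for crux `SignCone.ConeMagnification` (file 3 of 3)
(item stmt-RiemannHypothesis-16303, route route-RiemannHypothesis-SignCone; `--supports`, registered stub
`stub_deficitOfDesign`)

DESIGN DATA ⇒ DEFICIT SUMMABILITY (the finite spine of 2001 W-MAG Thm 1.2(i) / Thm 5.4).  Let `c ≥ 0` be a weight
with `c 1 = 0` and defect `d = c − Λ` such that (AX-A) `Σ_n |d(n)|/n < ∞`, (AX-B) the composite-mass series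
`Σ_{n ≥ 2 not a prime power} (c(n)/n)·e₂(n)` converges, and (AX-C) the Riesz–Euler design inequality
`Σ'_n (d(n)/n)·Φ_{S,a,φ}(n) ≤ 1/2` holds for every finite set `S` of primes, `a : S → [0,1]`, `φ ∈ ℝ`.  Then
`Σ_p (log p − c(p))₊ p^{-σ} < ∞` for every `σ > 1/2`.

Proof (2001 W-MAG, proof of Thm 5.4).  For `z ≥ 2` apply eq:beta1 (`stub_deficitOfDesign_beta1`, spine A) to
`S_z = {p ≤ z}` with `a_p = 𝟙_{c(p) < log p}`; split `√p ρ_{S_z}(p) = d(p)/√p + π_z(p)` (`Design.sqrt_mul_rho`), so that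
`a_p √p ρ(p) = −(log p − c p)₊/√p + a_p π_z(p)`; bound the pollution `Σ_p π_z(p)` by spine B
(`stub_deficitOfDesign_pollution`) and the tail `|ρ_{S_z}(1)| ≤ Σ_{k > z} |d(k)|/k` (`Design.abs_rho_one_le`, using
`c 1 = 0`).  This gives the finite-`z` inequality `Design.deficit_partial_le`, whose right side decreases in `z`, hence
bounded partial sums and `Design.deficit_summable` (scale `1/2`); finally `p^σ ≥ √p` for primes.

Adapted from the prior programme's kernel-checked stockroom file
`reserve/prior-2001/Prior/RiemannHypothesis/RiemannHypothesis/Rh_WMagnificationY1_MagDeficit.lean`; the junk-value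
hypothesis `c 0 = 0` of its interface is not needed (every series has the term `x / 0 = 0` at index `0`).
-/

noncomputable section

-- `Summit.RiemannHypothesis.RiemannHypothesis.…` repeats a namespace component by design (D-0017 layout).
set_option linter.dupNamespace false

open Finset

namespace Summit.RiemannHypothesis.RiemannHypothesis.Theorems.SignConeConeMagnification

namespace Design

section Deficit

variable {M : ℝ} {c : ℕ → ℝ}

-- adapted from reserve/prior-2001/Prior/RiemannHypothesis/RiemannHypothesis/Rh_WMagnificationY1_MagDeficit.lean (2001 programme)
/-- `d(1) = 0` when `c 1 = 0` (as `Λ(1) = 0`). [folklore] -/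
theorem dwt_one {c : ℕ → ℝ} (hc1 : c 1 = 0) : dwt c 1 = 0 := by
  simp [dwt, hc1]

/-- the splitting `√p · ρ_{S_z}(p) = d(p)/√p + π_z(p)` (2001 W-MAG, proof of Thm 5.4). [folklore] -/
theorem sqrt_mul_rho (hd : Summable fun n : ℕ => |dwt c n| / (n : ℝ)) {z p : ℕ}
    (hp : p ∈ Nat.primesLE z) :
    Real.sqrt p * rho c (Nat.primesLE z) p = dwt c p / Real.sqrt p + piZ c z p := by
  have hpp : p.Prime := Nat.prime_of_mem_primesLE hp
  have hppos : 0 < p := hpp.pos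
  set P : ℕ := ∏ q ∈ Nat.primesLE z, q with hP
  -- pointwise splitting of the ρ summand
  have hpt : ∀ k : ℕ,
      (if 1 ≤ k ∧ Nat.Coprime k P then dwt c (p * k) / ((p * k : ℕ) : ℝ) else 0)
        = (if k = 1 then dwt c p / (p : ℝ) else 0)
          + (if 2 ≤ k ∧ Nat.Coprime k P then dwt c (p * k) / ((p * k : ℕ) : ℝ) else 0) := by
    intro k
    rcases Nat.lt_or_ge k 2 with hk | hk
    · interval_cases k
      · rw [if_neg (by omega), if_neg (by omega), if_neg (by omega), add_zero]
      · rw [if_pos ⟨le_refl 1, Nat.coprime_one_left P⟩, if_pos rfl, if_neg (by omega),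
          add_zero, mul_one]
    · rw [if_neg (by omega : ¬ k = 1), zero_add]
      by_cases hcop : Nat.Coprime k P
      · rw [if_pos ⟨by omega, hcop⟩, if_pos ⟨hk, hcop⟩]
      · rw [if_neg (fun h => hcop h.2), if_neg (fun h => hcop h.2)]
  have hsum1 : Summable (fun k : ℕ => if k = 1 then dwt c p / (p : ℝ) else 0) :=
    (hasSum_ite_eq 1 (dwt c p / (p : ℝ))).summable
  have hsum2 : Summable (fun k : ℕ =>
      if 2 ≤ k ∧ Nat.Coprime k P then dwt c (p * k) / ((p * k : ℕ) : ℝ) else 0) :=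
    summable_ite_dwt hd hppos _
  have hsplit : rho c (Nat.primesLE z) p
      = dwt c p / (p : ℝ) + ∑' k : ℕ,
          (if 2 ≤ k ∧ Nat.Coprime k P then dwt c (p * k) / ((p * k : ℕ) : ℝ) else 0) := by
    rw [rho]
    rw [tsum_congr hpt, hsum1.tsum_add hsum2,
      tsum_ite_eq 1 (fun _ : ℕ => dwt c p / (p : ℝ))]
  rw [hsplit, mul_add]
  congr 1
  · -- √p · (d(p)/p) = d(p)/√p
    have hsq : Real.sqrt p ≠ 0 := ne_of_gt (Real.sqrt_pos.mpr (by exact_mod_cast hppos))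
    have hpne : ((p : ℕ) : ℝ) ≠ 0 := Nat.cast_ne_zero.mpr hppos.ne'
    rw [eq_div_iff hsq]
    have hre : Real.sqrt p * (dwt c p / (p : ℝ)) * Real.sqrt p
        = Real.sqrt p * Real.sqrt p * dwt c p / (p : ℝ) := by ring
    rw [hre, Real.mul_self_sqrt (Nat.cast_nonneg p)]
    exact mul_div_cancel_left₀ _ hpne
  · -- √p · (Σ' dwt-form) = π_z(p)
    rw [piZ]
    congr 1
    refine tsum_congr fun k => ?_
    by_cases hcond : 2 ≤ k ∧ Nat.Coprime k P
    · rw [if_pos hcond, if_pos hcond, c_eq_dwt_of_coprime (c := c) hp hcond.1 hcond.2]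
    · rw [if_neg hcond, if_neg hcond]

/-! #### The `ρ_S(1)` tail: `|ρ_{S_z}(1)| ≤ Σ_{n>z} |d(n)|/n` -/

/-- The `ρ_S(1)` tail bound `|ρ_{S_z}(1)| ≤ Σ_{k > z} |d(k)|/k` (2001 W-MAG, proof of Thm 5.4): the summand at
`k = 1` is `d(1) = 0`, and a `k ≥ 2` coprime to `Π_{S_z} p` exceeds `z`. [folklore] -/
theorem abs_rho_one_le (hc1 : c 1 = 0) (hd : Summable fun n : ℕ => |dwt c n| / (n : ℝ)) (z : ℕ) :
    |rho c (Nat.primesLE z) 1|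
      ≤ ∑' k : ℕ, (if z + 1 ≤ k then |dwt c k| / (k : ℝ) else 0) := by
  rw [rho]
  set P : ℕ := ∏ q ∈ Nat.primesLE z, q with hP
  set h : ℕ → ℝ := fun k =>
    if 1 ≤ k ∧ Nat.Coprime k P then dwt c (1 * k) / ((1 * k : ℕ) : ℝ) else 0 with hh
  have hsum : Summable h := summable_ite_dwt hd one_pos _
  have htail : Summable (fun k : ℕ => if z + 1 ≤ k then |dwt c k| / (k : ℝ) else 0) := by
    refine Summable.of_nonneg_of_le (fun k => ?_) (fun k => ?_) hd
    · split
      · positivity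
      · exact le_rfl
    · split
      · exact le_rfl
      · positivity
  have hpt : ∀ k : ℕ, |h k| ≤ (if z + 1 ≤ k then |dwt c k| / (k : ℝ) else 0) := by
    intro k
    simp only [hh]
    by_cases hcond : 1 ≤ k ∧ Nat.Coprime k P
    · rcases eq_or_lt_of_le hcond.1 with hk1 | hk2
      · -- k = 1 : the summand is d(1)/1 = 0
        rw [if_pos hcond, ← hk1]
        simp only [mul_one, Nat.cast_one]
        rw [dwt_one hc1]
        simp only [abs_zero, zero_div]
        split
        · positivity
        · exact le_rfl
      · -- k ≥ 2 : coprimality forces k > z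
        have hzk : z + 1 ≤ k := lt_of_coprime_prod hk2 hcond.2
        rw [if_pos hcond, if_pos hzk, one_mul, abs_div, Nat.abs_cast]
    · rw [if_neg hcond, abs_zero]
      split
      · positivity
      · exact le_rfl
  have h1 : ‖∑' k, h k‖ ≤ ∑' k, ‖h k‖ :=
    norm_tsum_le_tsum_norm (by simpa [Real.norm_eq_abs] using hsum.abs)
  rw [Real.norm_eq_abs] at h1
  have h2 : ∑' k, ‖h k‖ = ∑' k, |h k| := tsum_congr fun k => Real.norm_eq_abs _
  rw [h2] at h1
  exact h1.trans (hsum.abs.tsum_le_tsum hpt htail)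


/-! #### The finite-`z` deficit inequality (2001 W-MAG, proof of Thm 5.4) -/

/-- The finite-`z` deficit inequality (2001 W-MAG, proof of Thm 5.4): for `z ≥ 2`,
`Σ_{p ≤ z} (log p − c(p))₊/√p ≤ 2M + 4·Σ_{k>z} |d(k)|/k + (C_τ/τ_{z+1})·Σ_n compMassTerm c n` — eq:beta1 on `S_z` with
`a_p = 𝟙_{c(p) < log p}`, the splitting `√p ρ(p) = d(p)/√p + π_z(p)`, the pollution bound and the `ρ(1)` tail. [folklore] -/
theorem deficit_partial_le (hc : ∀ n, 0 ≤ c n) (hc1 : c 1 = 0)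
    (hd : Summable fun n : ℕ => |dwt c n| / (n : ℝ)) (hB : Summable (compMassTerm c))
    (hC : ∀ S : Finset ℕ, (∀ p ∈ S, p.Prime) → ∀ a : ℕ → ℝ,
      (∀ p ∈ S, 0 ≤ a p ∧ a p ≤ 1) → ∀ φ : ℝ,
      (∑' n : ℕ, dwt c n / (n : ℝ) * profile S a φ n) ≤ M / 2)
    {z : ℕ} (hz : 2 ≤ z) :
    ∑ p ∈ Nat.primesLE z, max (Real.log p - c p) 0 / Real.sqrt p
      ≤ 2 * M + 4 * (∑' k : ℕ, if z + 1 ≤ k then |dwt c k| / (k : ℝ) else 0)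
        + (cTau / tauP (z + 1)) * ∑' n : ℕ, compMassTerm c n := by
  have hSp : ∀ p ∈ Nat.primesLE z, p.Prime := fun p hp => Nat.prime_of_mem_primesLE hp
  have hSne := primesLE_nonempty hz
  set a : ℕ → ℝ := fun p => if c p < Real.log p then 1 else 0 with ha
  have hab : ∀ p ∈ Nat.primesLE z, 0 ≤ a p ∧ a p ≤ 1 := by
    intro p _
    simp only [ha]
    split <;> norm_num
  have hbeta := abs_sum_sqrt_rho_le hd hC hSp hSne hab
  have hterm : ∀ p ∈ Nat.primesLE z,
      a p * Real.sqrt p * rho c (Nat.primesLE z) p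
        = -(max (Real.log p - c p) 0 / Real.sqrt p) + a p * piZ c z p := by
    intro p hp
    have hpp := Nat.prime_of_mem_primesLE hp
    have h1 : a p * Real.sqrt p * rho c (Nat.primesLE z) p
        = a p * (Real.sqrt p * rho c (Nat.primesLE z) p) := by ring
    rw [h1, sqrt_mul_rho hd hp, mul_add]
    congr 1
    simp only [ha]
    by_cases hlt : c p < Real.log p
    · rw [if_pos hlt, one_mul, dwt, ArithmeticFunction.vonMangoldt_apply_prime hpp,
        max_eq_left (by linarith)]
      ring
    · rw [if_neg hlt, zero_mul, max_eq_right (by linarith [not_lt.mp hlt]), zero_div,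
        neg_zero]
  have hsum_eq : ∑ p ∈ Nat.primesLE z, a p * Real.sqrt p * rho c (Nat.primesLE z) p
      = -(∑ p ∈ Nat.primesLE z, max (Real.log p - c p) 0 / Real.sqrt p)
        + ∑ p ∈ Nat.primesLE z, a p * piZ c z p := by
    rw [Finset.sum_congr rfl hterm, Finset.sum_add_distrib, Finset.sum_neg_distrib]
  rw [hsum_eq] at hbeta
  obtain ⟨hb1, -⟩ := abs_le.mp hbeta
  have hPz0 : 0 ≤ ∑ p ∈ Nat.primesLE z, a p * piZ c z p :=
    Finset.sum_nonneg fun p hp => mul_nonneg (hab p hp).1 (piZ_nonneg hc z p)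
  have hPzle : ∑ p ∈ Nat.primesLE z, a p * piZ c z p ≤ ∑ p ∈ Nat.primesLE z, piZ c z p :=
    Finset.sum_le_sum fun p hp =>
      mul_le_of_le_one_left (piZ_nonneg hc z p) (hab p hp).2
  have hPiZ := sum_piZ_le hc hd hB hz
  have hrho := abs_rho_one_le hc1 hd z
  have hneg : -(rho c (Nat.primesLE z) 1) ≤ |rho c (Nat.primesLE z) 1| := neg_le_abs _
  linarith

end Deficit

/-! ### Summability of the deficit series (2001 W-MAG Thm 1.2(i) / Thm 5.4) -/

section Main

variable {M : ℝ} {c : ℕ → ℝ}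

/-- `Σ_{n ≤ z} deficitTerm c n = Σ_{p ∈ S_z} (log p − c p)₊/√p`. [folklore] -/
theorem sum_range_deficitTerm (c : ℕ → ℝ) (z : ℕ) :
    ∑ n ∈ Finset.range (z + 1), deficitTerm c n
      = ∑ p ∈ Nat.primesLE z, max (Real.log p - c p) 0 / Real.sqrt p := by
  rw [Nat.primesLE_eq_filter_range, Finset.sum_filter]
  exact Finset.sum_congr rfl fun n _ => rfl

/-- The tails `Σ_{k > w} |d(k)|/k` converge under AX-A. [folklore] -/
theorem summable_tail (hd : Summable fun n : ℕ => |dwt c n| / (n : ℝ)) (w : ℕ) :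
    Summable (fun k : ℕ => if w + 1 ≤ k then |dwt c k| / (k : ℝ) else 0) := by
  refine Summable.of_nonneg_of_le (fun k => ?_) (fun k => ?_) hd
  · split
    · positivity
    · exact le_rfl
  · split
    · exact le_rfl
    · positivity

/-- The tails `Σ_{k > z} |d(k)|/k` decrease in `z`. [folklore] -/
theorem tail_antitone (hd : Summable fun n : ℕ => |dwt c n| / (n : ℝ)) {z z' : ℕ}
    (hzz : z ≤ z') :
    (∑' k : ℕ, if z' + 1 ≤ k then |dwt c k| / (k : ℝ) else 0)
      ≤ ∑' k : ℕ, if z + 1 ≤ k then |dwt c k| / (k : ℝ) else 0 := by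
  refine (summable_tail hd z').tsum_le_tsum (fun k => ?_) (summable_tail hd z)
  by_cases h : z' + 1 ≤ k
  · rw [if_pos h, if_pos (by omega)]
  · rw [if_neg h]
    split
    · positivity
    · exact le_rfl

/-- `C_τ/τ_{z+1}` decreases in `z ≥ 1`. [folklore] -/
theorem cTau_div_antitone {z z' : ℕ} (hz : 1 ≤ z) (hzz : z ≤ z') :
    cTau / tauP (z' + 1) ≤ cTau / tauP (z + 1) := by
  have h1 : 0 < tauP (z + 1) := tauP_pos (by omega)
  have h2 : 0 < tauP (z' + 1) := tauP_pos (by omega)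
  have h3 : tauP (z + 1) ≤ tauP (z' + 1) := tauP_mono (by omega)
  rw [div_le_div_iff₀ h2 h1]
  exact mul_le_mul_of_nonneg_left h3 cTau_nonneg

/-- **2001 W-MAG Thm 1.2(i), summability half**: under the design data at slack `M`, the deficit series
`Σ_p (log p − c(p))₊/√p` converges (its partial sums are bounded by `deficit_partial_le` at `z = N + 2`,
whose right side decreases in `z`). [folklore] -/
theorem deficit_summable (hc : ∀ n, 0 ≤ c n) (hc1 : c 1 = 0)
    (hd : Summable fun n : ℕ => |dwt c n| / (n : ℝ)) (hB : Summable (compMassTerm c))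
    (hC : ∀ S : Finset ℕ, (∀ p ∈ S, p.Prime) → ∀ a : ℕ → ℝ,
      (∀ p ∈ S, 0 ≤ a p ∧ a p ≤ 1) → ∀ φ : ℝ,
      (∑' n : ℕ, dwt c n / (n : ℝ) * profile S a φ n) ≤ M / 2) :
    Summable (deficitTerm c) := by
  refine summable_of_sum_range_le (c := 2 * M
      + 4 * (∑' k : ℕ, if 2 + 1 ≤ k then |dwt c k| / (k : ℝ) else 0)
      + (cTau / tauP (2 + 1)) * ∑' n : ℕ, compMassTerm c n)
    (fun n => deficitTerm_nonneg c n) (fun N => ?_)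
  have h1 : ∑ n ∈ Finset.range N, deficitTerm c n
      ≤ ∑ n ∈ Finset.range (N + 3), deficitTerm c n :=
    Finset.sum_le_sum_of_subset_of_nonneg
      (by intro x hx; simp only [Finset.mem_range] at hx ⊢; omega)
      (fun n _ _ => deficitTerm_nonneg c n)
  have h2 : ∑ n ∈ Finset.range (N + 3), deficitTerm c n
      = ∑ p ∈ Nat.primesLE (N + 2), max (Real.log p - c p) 0 / Real.sqrt p := by
    rw [show N + 3 = (N + 2) + 1 by omega]
    exact sum_range_deficitTerm c (N + 2)
  have h3 := deficit_partial_le hc hc1 hd hB hC (z := N + 2) (by omega)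
  have h4 : (∑' k : ℕ, if (N + 2) + 1 ≤ k then |dwt c k| / (k : ℝ) else 0)
      ≤ ∑' k : ℕ, if 2 + 1 ≤ k then |dwt c k| / (k : ℝ) else 0 :=
    tail_antitone hd (by omega)
  have h5 : cTau / tauP ((N + 2) + 1) ≤ cTau / tauP (2 + 1) :=
    cTau_div_antitone (by omega) (by omega)
  have h6 : 0 ≤ ∑' n : ℕ, compMassTerm c n := tsum_nonneg (compMassTerm_nonneg hc)
  have h7 : cTau / tauP ((N + 2) + 1) * (∑' n : ℕ, compMassTerm c n)
      ≤ cTau / tauP (2 + 1) * (∑' n : ℕ, compMassTerm c n) :=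
    mul_le_mul_of_nonneg_right h5 h6
  linarith

end Main

end Design

/-! ### The registered stub -/

open Design in
/-- **Stub `stub_deficitOfDesign`** (line `Sketch` of `SignCone.ConeMagnification`; the finite spine of the 2001
W-MAG programme, §5): design data (AX-A, AX-B, AX-C at slack `M = 1`) for a weight `c ≥ 0` with `c 1 = 0` imply
summability of the one-sided prime deficit `Σ_p (log p − c(p))₊ p^{-σ}` for every `σ > 1/2` — indeed at the scale
`1/2` (`Design.deficit_summable`), and `p^σ ≥ √p` for primes `p`. [folklore] -/
theorem stub_deficitOfDesign :
    ∀ c : ℕ → ℝ, (∀ n, 0 ≤ c n) → c 1 = 0 →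
      Summable (fun n : ℕ => |c n - ArithmeticFunction.vonMangoldt n| / (n : ℝ)) →
      Summable (fun n : ℕ => if 2 ≤ n ∧ ¬ IsPrimePow n then
        c n / (n : ℝ) * (∑ q ∈ n.primeFactors, ∑ q' ∈ n.primeFactors.filter (fun q' => q < q'),
          ((Real.sqrt q - 1) / 2) * ((Real.sqrt q' - 1) / 2)) else 0) →
      (∀ S : Finset ℕ, (∀ p ∈ S, p.Prime) → ∀ a : ℕ → ℝ, (∀ p ∈ S, 0 ≤ a p ∧ a p ≤ 1) → ∀ φ : ℝ,
        (∑' n : ℕ, (c n - ArithmeticFunction.vonMangoldt n) / (n : ℝ) *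
          (if ∀ p ∈ S, ¬ (p ^ 2 ∣ n) then
            Real.sqrt (∏ p ∈ S.filter (· ∣ n), (p : ℝ)) * (∏ p ∈ S.filter (· ∣ n), a p) *
              (1 / 2) ^ (S.filter (· ∣ n)).card * Real.cos (((S.filter (· ∣ n)).card : ℝ) * φ)
          else 0)) ≤ 1 / 2) →
      ∀ σ : ℝ, 1 / 2 < σ →
        Summable (fun p : ℕ => if p.Prime then max (Real.log p - c p) 0 / (p : ℝ) ^ σ else 0) := by
  intro c hc hc1 hA hB hC σ hσ
  have hd : Summable fun n : ℕ => |dwt c n| / (n : ℝ) := hA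
  have hB' : Summable (compMassTerm c) := hB
  have hC' : ∀ S : Finset ℕ, (∀ p ∈ S, p.Prime) → ∀ a : ℕ → ℝ,
      (∀ p ∈ S, 0 ≤ a p ∧ a p ≤ 1) → ∀ φ : ℝ,
      (∑' n : ℕ, dwt c n / (n : ℝ) * profile S a φ n) ≤ (1 : ℝ) / 2 := hC
  have hdef := deficit_summable hc hc1 hd hB' hC'
  refine Summable.of_nonneg_of_le (fun p => ?_) (fun p => ?_) hdef
  · split
    · exact div_nonneg (le_max_right _ _) (Real.rpow_nonneg (Nat.cast_nonneg p) σ)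
    · exact le_rfl
  · simp only [deficitTerm]
    by_cases hp : p.Prime
    · rw [if_pos hp, if_pos hp]
      have hp1 : (1 : ℝ) < (p : ℝ) := by exact_mod_cast hp.one_lt
      have hppos : (0 : ℝ) < (p : ℝ) := by positivity
      have hs : Real.sqrt p ≤ (p : ℝ) ^ σ := by
        rw [Real.sqrt_eq_rpow]
        exact (Real.rpow_le_rpow_left_iff hp1).mpr (by linarith)
      exact div_le_div_of_nonneg_left (le_max_right _ _) (Real.sqrt_pos.mpr hppos) hs
    · rw [if_neg hp, if_neg hp]

end Summit.RiemannHypothesis.RiemannHypothesis.Theorems.SignConeConeMagnification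

end
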